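import Summits.Ventures.YMGap.FlowData.RectTubeTorelonEnvelope
import Summits.Ventures.YMGap.FlowData.TubeFluxNonAnnihilationAll
import HarnessLib

/-!
# Venture YMGap, track Y3 FLOW-DATA — rectangular tubes `Π_i ℤ/(Ls i)`: the quantitative multi-loop witness
# `e^{−|J| n P} c₀^{N−Σ_{e_μ=1} Ls μ} λ^{Σ_{e_μ=1} Ls μ} ≤ ‖T ∘ P_e‖` for EVERY centre flux `e` (theorems only)

HONEST FRAMING: venture file of the cell `pub-ymgap` (QuantumFields programme), track Y3; the v2 (rectangular,
`FlowData/RectTubeTransferOperator.lean`) twin of `FlowData/TubeSectorNormLowerBound.lean`, preparing the strong-coupling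
window of EVERY flux energy on the FLOW-TABLE's `2×3`, `2×4` cross-sections (`E2 = E_{(1,1)}` rows).  Finite spatial torus,
compact group, continuous unitary `ρ` with `ρ(z) = −1`, `z` central; no number, no row, nothing about limits, the continuum or
a mass gap.

* `rectTubeSectorNorm_ge_of_pathState` — a gauge-invariant holonomy trace on `m` distinct links with twist eigenvalues
  `χ_e(s)` gives `e^{−|J| n P} c₀^{N−m} λ^m ≤ ‖T ∘ P_e‖` (`c₀ = ∫ e^{J Re tr ρ}`, `λ` the Schur scalar, `N` links,
  `P = #sites · k(k−1)/2` plaquettes) — the quantitative form of `RectTubeFluxNonAnnihilation.rectTubeSectorNorm_pos_of_pathState`;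
* `exists_rectBlockPath` — THE RECTANGULAR STAIRCASE: for every duplicate-free list of directions `ν₀, …, ν_{r−1}` the closed
  path winding the `ν₀`-cycle (length `Ls ν₀`) through the origin, then the `ν₁`-cycle, … consists of `Σ_q Ls ν_q` distinct
  links, its holonomy is conjugated by gauge transformations, and a centre twist `s` inserts the central factor
  `∏_q z^{[s_{ν_q} = 1]}` (built by `Fin.append`, block by block);
* `map_list_prod_ite_center`, `fluxSign_eq_list_prod` — for `ρ(z) = −1` that factor acts as the sign `χ_e(s)`, `e` the
  indicator of `{ν₀, …, ν_{r−1}}`;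
* `sum_support_le_card_links` — `Σ_{e_μ = 1} Ls μ ≤ N`;
* **`rectTubeSectorNorm_ge`** — `e^{−|J| n P} c₀^{N − Σ_{e_μ=1} Ls μ} λ^{Σ_{e_μ=1} Ls μ} ≤ ‖T ∘ P_e‖` for EVERY `e`.

References: G. 't Hooft, Nucl. Phys. B 153 (1979) 141 [cite: tHooft1979Flux]; I. Montvay, G. Münster (1994) §3.2.6
[cite: MontvayMunster1994, §3.2.6].
-/

noncomputable section

open scoped BigOperators
open MeasureTheory Filter Function
open Literature.MathematicalPhysics.QuantumFieldTheory Literature.Analysis.OperatorTheory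
open Literature.Barriers.QuantumFields
open Literature.MathematicalPhysics.QuantumLattice (RectTorusSite)

namespace Summit.Ventures.YMGap.FlowData

/-! ### The rectangular staircase path (pure group algebra) -/

section BlockPath

variable {G : Type*} [Group G] {k : ℕ} {Ls : Fin k → ℕ} [∀ i, NeZero (Ls i)]

omit [∀ i, NeZero (Ls i)] in
/-- Mapping an appended tuple: `[F (a ⧺ b)ₜ]ₜ = [F aᵢ]ᵢ ++ [F bⱼ]ⱼ` as lists. [folklore] -/
theorem ofFn_fin_append_comp {α β : Type*} {m m' : ℕ} (F : α → β) (a : Fin m → α) (b : Fin m' → α) :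
    (List.ofFn fun t => F (Fin.append a b t)) = (List.ofFn fun i => F (a i)) ++ List.ofFn fun j => F (b j) := by
  rw [List.ofFn_add]
  simp only [Fin.append_left', Fin.append_right]

/-- **The rectangular staircase path.**  For every duplicate-free list `l = [ν₀, …, ν_{r−1}]` of directions there is an
injective family of `m = Σ_q Ls ν_q` links of the rectangular torus — the closed path that winds the `ν₀`-cycle through the
origin, then the `ν₁`-cycle, … — all of whose links point in directions of `l`, whose holonomy is CONJUGATED by every gauge
transformation (`∏ₜ γ(x_t) b(ℓ t) γ(x_t + ê)⁻¹ = γ(0) (∏ₜ b(ℓ t)) γ(0)⁻¹`), and on which a centre twist `s` (central `z`)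
inserts the central factor `∏_q z^{[s_{ν_q} = 1]}` in front of the holonomy. [cite: tHooft1979Flux] -/
theorem exists_rectBlockPath {z : G} (hz : z ∈ Subgroup.center G) : ∀ (l : List (Fin k)), l.Nodup →
    ∃ (m : ℕ) (ℓ : Fin m → RectTorusSite Ls × Fin k), m = (l.map fun ν => Ls ν).sum ∧ Injective ℓ ∧
      (∀ t, (ℓ t).2 ∈ l) ∧
      (∀ (γ : RectTorusSite Ls → G) (b : RectSlice Ls G),
        (List.ofFn fun t => γ (ℓ t).1 * b (ℓ t) * (γ ((ℓ t).1 + Pi.single (ℓ t).2 1))⁻¹).prod =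
          γ 0 * (List.ofFn fun t => b (ℓ t)).prod * (γ 0)⁻¹) ∧
      (∀ (s : Fin k → ZMod 2) (b : RectSlice Ls G),
        (List.ofFn fun t => rectFluxTwist z s b (ℓ t)).prod =
          (l.map fun ν => if s ν = 1 then z else 1).prod * (List.ofFn fun t => b (ℓ t)).prod)
  | [], _ => ⟨0, Fin.elim0, by simp, fun t => Fin.elim0 t, fun t => Fin.elim0 t, fun γ b => by simp, fun s b => by simp⟩
  | ν :: l, hl => by
    obtain ⟨hν, hl'⟩ := List.nodup_cons.1 hl
    obtain ⟨m, ℓ, hm, hinj, hdir, hWg, hWs⟩ := exists_rectBlockPath hz l hl'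
    refine ⟨Ls ν + m,
      Fin.append (fun t : Fin (Ls ν) => ((Pi.single ν ((t : ℕ) : ZMod (Ls ν)), ν) : RectTorusSite Ls × Fin k)) ℓ,
      ?_, ?_, ?_, ?_, ?_⟩
    · rw [List.map_cons, List.sum_cons, hm]
    · rw [Fin.append_injective_iff]
      refine ⟨rectLine_injective ν, hinj, fun i j h => hν ?_⟩
      have h2 : ν = (ℓ j).2 := congrArg Prod.snd h
      rw [h2]
      exact hdir j
    · intro t
      refine Fin.addCases (fun i => ?_) (fun j => ?_) t
      · rw [Fin.append_left]
        exact List.mem_cons_self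
      · rw [Fin.append_right]
        exact List.mem_cons_of_mem ν (hdir j)
    · intro γ b
      -- name the gauge-transformed configuration (keeps the rewriting below non-dependent)
      set F : RectTorusSite Ls × Fin k → G := fun e => γ e.1 * b e * (γ (e.1 + Pi.single e.2 1))⁻¹ with hF
      change (List.ofFn fun t => F (Fin.append
          (fun t : Fin (Ls ν) => ((Pi.single ν ((t : ℕ) : ZMod (Ls ν)), ν) : RectTorusSite Ls × Fin k)) ℓ t)).prod =
        γ 0 * (List.ofFn fun t => b (Fin.append
          (fun t : Fin (Ls ν) => ((Pi.single ν ((t : ℕ) : ZMod (Ls ν)), ν) : RectTorusSite Ls × Fin k)) ℓ t)).prod *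
          (γ 0)⁻¹
      have h1 : (List.ofFn fun t : Fin (Ls ν) => F (Pi.single ν ((t : ℕ) : ZMod (Ls ν)), ν)).prod =
          γ 0 * (List.ofFn fun t : Fin (Ls ν) => b (Pi.single ν ((t : ℕ) : ZMod (Ls ν)), ν)).prod * (γ 0)⁻¹ :=
        prod_ofFn_rectLine_gauge ν γ b
      have h2 : (List.ofFn fun t => F (ℓ t)).prod = γ 0 * (List.ofFn fun t => b (ℓ t)).prod * (γ 0)⁻¹ := hWg γ b
      rw [ofFn_fin_append_comp F, List.prod_append, ofFn_fin_append_comp b, List.prod_append, h1, h2]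
      group
    · intro s b
      rw [ofFn_fin_append_comp (rectFluxTwist z s b)
          (fun t : Fin (Ls ν) => ((Pi.single ν ((t : ℕ) : ZMod (Ls ν)), ν) : RectTorusSite Ls × Fin k)) ℓ,
        List.prod_append,
        ofFn_fin_append_comp b
          (fun t : Fin (Ls ν) => ((Pi.single ν ((t : ℕ) : ZMod (Ls ν)), ν) : RectTorusSite Ls × Fin k)) ℓ,
        List.prod_append, List.map_cons, List.prod_cons, prod_ofFn_rectLine_fluxTwist z s ν b, hWs s b]
      -- the inserted factor of the tail is central: move it to the front
      have hc : (l.map fun ν => if s ν = 1 then z else 1).prod ∈ Subgroup.center G :=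
        Subgroup.list_prod_mem _ fun x hx => by
          obtain ⟨ν', -, rfl⟩ := List.mem_map.1 hx
          split_ifs
          · exact hz
          · exact Subgroup.one_mem _
      have hcomm := Subgroup.mem_center_iff.1 hc
        (List.ofFn fun t : Fin (Ls ν) => b (Pi.single ν ((t : ℕ) : ZMod (Ls ν)), ν)).prod
      -- `(c₁ A) (c B) = c₁ (A c) B = c₁ (c A) B = (c₁ c) (A B)`
      rw [mul_assoc, ← mul_assoc (List.ofFn fun t : Fin (Ls ν) => b (Pi.single ν ((t : ℕ) : ZMod (Ls ν)), ν)).prod,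
        hcomm, mul_assoc, mul_assoc]

end BlockPath

/-! ### Signs: for `ρ(z) = −1` the inserted central factor is the character `χ_e(s)` -/

section Signs

variable {G : Type*} [Group G] {n k : ℕ} (ρ : G →* Matrix (Fin n) (Fin n) ℂ)

/-- The image of `∏_{ν ∈ l} z^{[s_ν = 1]}`, `ρ(z) = −1`, is the real sign `∏_{ν ∈ l} (−1)^{[s_ν = 1]}` times `1`. [folklore] -/
theorem map_list_prod_ite_center {z : G} (hρz : ρ z = -1) (s : Fin k → ZMod 2) : ∀ l : List (Fin k),
    ρ ((l.map fun ν => if s ν = 1 then z else 1).prod) =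
      (((l.map fun ν => if s ν = 1 then (-1 : ℝ) else 1).prod : ℝ) : ℂ) • (1 : Matrix (Fin n) (Fin n) ℂ)
  | [] => by simp
  | ν :: l => by
    rw [List.map_cons, List.prod_cons, map_mul, map_list_prod_ite_center hρz s l, List.map_cons, List.prod_cons]
    by_cases h : s ν = 1
    · simp only [h, if_true, hρz]
      rw [Complex.ofReal_mul, mul_smul, Complex.ofReal_neg, Complex.ofReal_one, neg_one_smul, neg_mul, one_mul]
    · simp only [h, if_false, map_one, one_mul]

/-- The sign character of the indicator `e` of a duplicate-free list `l` of directions is the list product of the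
block signs: `χ_e(s) = ∏_{ν ∈ l} (−1)^{[s_ν = 1]}`. [folklore] -/
theorem fluxSign_eq_list_prod (e s : Fin k → ZMod 2) {l : List (Fin k)} (hl : l.Nodup) (he : ∀ ν, e ν = 1 ↔ ν ∈ l) :
    fluxSign e s = (l.map fun ν => if s ν = 1 then (-1 : ℝ) else 1).prod := by
  classical
  unfold fluxSign
  have h1 : ∀ ν, (if e ν = 1 ∧ s ν = 1 then (-1 : ℝ) else 1) =
      if ν ∈ l.toFinset then (if s ν = 1 then (-1 : ℝ) else 1) else 1 := by
    intro ν
    by_cases hν : ν ∈ l.toFinset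
    · simp only [(he ν).2 (List.mem_toFinset.1 hν), true_and, hν, if_true]
    · have : ¬ e ν = 1 := fun h => hν (List.mem_toFinset.2 ((he ν).1 h))
      simp only [this, false_and, if_false, hν]
  simp_rw [h1]
  rw [Finset.prod_ite_mem, Finset.univ_inter, List.prod_toFinset _ hl]

end Signs

/-! ### The quantitative path-state witness on the rectangular slice (general compact group) -/

section PathState

variable {G : Type*} [Group G] [TopologicalSpace G] [IsTopologicalGroup G] [CompactSpace G]
  [MeasurableSpace G] [BorelSpace G] [SecondCountableTopology G] {n : ℕ} (ρ : G →* Matrix (Fin n) (Fin n) ℂ)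
  (J : ℝ) {k : ℕ} {Ls : Fin k → ℕ} [∀ i, NeZero (Ls i)]

/-- **Quantitative path-state witness** (rectangular slice): a gauge-invariant holonomy trace along `m` distinct links
with twist eigenvalues `χ_e(s)` gives `e^{−|J| n P} c₀^{N−m} λ^m ≤ ‖T ∘ P_e‖` (`c₀ = ∫ e^{J Re tr ρ}`, `λ` the Schur scalar,
`N` links, `P = #sites · k(k−1)/2` plaquettes; unitary continuous `ρ`, `n ≠ 0`, `z` central) — the state's norm is at most
`e^{|J| n P/2}` times that of its trace, and `⟪ψ, Tψ⟫ = c₀^{N−m} λ^m ∫ W²`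
(`RectTubeFluxNonAnnihilation.inner_rectTubeTransferOperator_pathState`). [cite: tHooft1979Flux] [cite: MontvayMunster1994, §3.2.6] -/
theorem rectTubeSectorNorm_ge_of_pathState (hρ : Continuous ρ) (hρu : ∀ g, ρ g ∈ Matrix.unitaryGroup (Fin n) ℂ) (hn : n ≠ 0)
    {z : G} (hz : z ∈ Subgroup.center G) {lam : ℝ}
    (hM : ∀ i j, ∫ c, (Real.exp (J * (ρ c).trace.re) : ℂ) * ρ c i j ∂haarProbability G = if i = j then (lam : ℂ) else 0)
    {m : ℕ} (ℓ : Fin m → RectTorusSite Ls × Fin k) (hℓ : Injective ℓ) (e : Fin k → ZMod 2)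
    (hWg : ∀ (γ : RectTorusSite Ls → G) (b : RectSlice Ls G),
      (ρ ((List.ofFn fun t : Fin m =>
        (fun e' : RectTorusSite Ls × Fin k => γ e'.1 * b e' * (γ (e'.1 + Pi.single e'.2 1))⁻¹) (ℓ t)).prod)).trace.re =
        (ρ ((List.ofFn fun t : Fin m => b (ℓ t)).prod)).trace.re)
    (hWs : ∀ (s : Fin k → ZMod 2) (b : RectSlice Ls G),
      (ρ ((List.ofFn fun t : Fin m => rectFluxTwist z s b (ℓ t)).prod)).trace.re =
        fluxSign e s * (ρ ((List.ofFn fun t : Fin m => b (ℓ t)).prod)).trace.re) :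
    Real.exp (-(|J| * (n * (Fintype.card (RectTorusSite Ls) * Fintype.card {p : Fin k × Fin k // p.1 < p.2})))) *
        ((∫ g, Real.exp (J * (ρ g).trace.re) ∂haarProbability G) ^ (Fintype.card (RectTorusSite Ls × Fin k) - m) * lam ^ m) ≤
      rectTubeSectorNorm ρ z J Ls e := by
  set W : RectSlice Ls G → ℝ := fun b => (ρ ((List.ofFn fun t : Fin m => b (ℓ t)).prod)).trace.re with hW
  set f : RectSlice Ls G → ℝ := fun b => Real.exp (-(J / 2 * rectMagSum (Ls := Ls) ρ b)) * W b with hf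
  set P : ℝ := n * (Fintype.card (RectTorusSite Ls) * Fintype.card {p : Fin k × Fin k // p.1 < p.2}) with hP
  have hWc : Continuous W :=
    Complex.continuous_re.comp ((hρ.comp (continuous_prod_ofFn_apply m ℓ)).matrix_trace)
  have hfc : Continuous f :=
    (Real.continuous_exp.comp (continuous_const.mul (continuous_rectMagSum (Ls := Ls) ρ hρ)).neg).mul hWc
  obtain ⟨Cf, hCf⟩ := isCompact_univ.exists_bound_of_continuousOn hfc.continuousOn
  have hmem : MemLp f 2 (rectSliceMeasure G Ls) :=
    MemLp.of_bound hfc.aestronglyMeasurable Cf (Eventually.of_forall fun b => hCf b (Set.mem_univ _))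
  have heig : ∀ s : Fin k → ZMod 2, rectFluxTwistOp Ls z s (hmem.toLp f) = fluxSign e s • hmem.toLp f := by
    intro s
    refine rectFluxTwistOp_toLp_eq_smul z s hmem _ fun b => ?_
    have hWs' : W (rectFluxTwist z s b) = fluxSign e s * W b := by simp only [hW]; exact hWs s b
    simp only [hf]
    rw [rectMagSum_fluxTwist ρ hz, hWs']
    ring
  have hP1 : rectTubeFluxProjection z Ls e (hmem.toLp f) = hmem.toLp f :=
    rectTubeFluxProjection_apply_of_twist_eigen z heig
  have hinner := inner_rectTubeTransferOperator_pathState ρ J hρ hM ℓ hℓ hWg hmem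
  -- `‖ψ‖² ≤ e^{|J| n P} ∫ W²`
  have hW2i : Integrable (fun b => W b ^ 2) (rectSliceMeasure G Ls) :=
    (hWc.pow 2).integrable_of_hasCompactSupport (HasCompactSupport.of_compactSpace _)
  have hnorm : ‖hmem.toLp f‖ ^ 2 ≤ Real.exp (|J| * P) * ∫ b, W b ^ 2 ∂(rectSliceMeasure G Ls) := by
    rw [norm_sq_eq_integral_sq, ← integral_const_mul]
    have hae := hmem.coeFn_toLp
    refine integral_mono_ae ((Lp.memLp (hmem.toLp f)).integrable_sq) (hW2i.const_mul _) ?_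
    filter_upwards [hae] with b hb
    rw [hb]
    simp only [hf]
    rw [mul_pow, ← Real.exp_nat_mul]
    have h2 : ((2 : ℕ) : ℝ) * -(J / 2 * rectMagSum (Ls := Ls) ρ b) = -(J * rectMagSum (Ls := Ls) ρ b) := by
      push_cast; ring
    rw [h2]
    exact mul_le_mul_of_nonneg_right (exp_neg_rectMagSum_le ρ J hρu b) (sq_nonneg _)
  -- `⟪ψ, Tψ⟫ = ⟪ψ, (T P) ψ⟫ ≤ ‖T P‖ ‖ψ‖²`
  have hle : (∫ g, Real.exp (J * (ρ g).trace.re) ∂haarProbability G) ^ (Fintype.card (RectTorusSite Ls × Fin k) - m) * lam ^ m *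
      ∫ b, W b ^ 2 ∂(rectSliceMeasure G Ls) ≤ rectTubeSectorNorm ρ z J Ls e * ‖hmem.toLp f‖ ^ 2 := by
    rw [← hinner]
    have h := real_inner_le_norm (hmem.toLp f)
      (((rectTubeTransferOperator ρ J Ls).comp (rectTubeFluxProjection z Ls e)) (hmem.toLp f))
    rw [ContinuousLinearMap.comp_apply, hP1] at h
    refine h.trans ?_
    have h2 := ((rectTubeTransferOperator ρ J Ls).comp (rectTubeFluxProjection z Ls e)).le_opNorm (hmem.toLp f)
    rw [ContinuousLinearMap.comp_apply, hP1] at h2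
    unfold rectTubeSectorNorm sectorNorm
    calc ‖hmem.toLp f‖ * ‖rectTubeTransferOperator ρ J Ls (hmem.toLp f)‖
        ≤ ‖hmem.toLp f‖ * (‖(rectTubeTransferOperator ρ J Ls).comp (rectTubeFluxProjection z Ls e)‖ *
            ‖hmem.toLp f‖) := mul_le_mul_of_nonneg_left h2 (norm_nonneg _)
      _ = ‖(rectTubeTransferOperator ρ J Ls).comp (rectTubeFluxProjection z Ls e)‖ * ‖hmem.toLp f‖ ^ 2 := by
          ring
  have hS0 : 0 ≤ rectTubeSectorNorm ρ z J Ls e := sectorNorm_nonneg _ _ _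
  -- combine: `c λ^m ∫W² ≤ S ‖ψ‖² ≤ S e^{|J|P} ∫W²`
  have h3 : (∫ g, Real.exp (J * (ρ g).trace.re) ∂haarProbability G) ^ (Fintype.card (RectTorusSite Ls × Fin k) - m) * lam ^ m *
      ∫ b, W b ^ 2 ∂(rectSliceMeasure G Ls) ≤
      rectTubeSectorNorm ρ z J Ls e * (Real.exp (|J| * P) * ∫ b, W b ^ 2 ∂(rectSliceMeasure G Ls)) :=
    hle.trans (mul_le_mul_of_nonneg_left hnorm hS0)
  have hW1 : W 1 = n := by
    have h : (List.ofFn fun t : Fin m => (1 : RectSlice Ls G) (ℓ t)).prod = 1 := by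
      simp only [Pi.one_apply, List.ofFn_const, List.prod_replicate, one_pow]
    simp only [hW, h, map_one, Matrix.trace_one, Fintype.card_fin, Complex.natCast_re]
  have hW2pos : 0 < ∫ b, W b ^ 2 ∂(rectSliceMeasure G Ls) :=
    Continuous.integral_pos_of_hasCompactSupport_nonneg_nonzero (x := 1) (hWc.pow 2)
      (HasCompactSupport.of_compactSpace _) (fun b => sq_nonneg _)
      (by rw [hW1]; exact pow_ne_zero 2 (Nat.cast_ne_zero.2 hn))
  have hexp : 0 < Real.exp (|J| * P) := Real.exp_pos _
  have h4 : (∫ g, Real.exp (J * (ρ g).trace.re) ∂haarProbability G) ^ (Fintype.card (RectTorusSite Ls × Fin k) - m) * lam ^ m ≤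
      rectTubeSectorNorm ρ z J Ls e * Real.exp (|J| * P) :=
    le_of_mul_le_mul_right (by nlinarith [h3]) hW2pos
  rw [Real.exp_neg]
  calc (Real.exp (|J| * P))⁻¹ *
        ((∫ g, Real.exp (J * (ρ g).trace.re) ∂haarProbability G) ^ (Fintype.card (RectTorusSite Ls × Fin k) - m) * lam ^ m)
      ≤ (Real.exp (|J| * P))⁻¹ * (rectTubeSectorNorm ρ z J Ls e * Real.exp (|J| * P)) :=
        mul_le_mul_of_nonneg_left h4 (inv_nonneg.2 hexp.le)
    _ = rectTubeSectorNorm ρ z J Ls e := by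
        field_simp

omit [TopologicalSpace G] [IsTopologicalGroup G] [CompactSpace G] [MeasurableSpace G] [BorelSpace G]
  [SecondCountableTopology G] in
/-- **`Σ_{e_μ = 1} Ls μ ≤ N`**: the staircase path of the support of `e` has that many distinct links. [folklore] -/
theorem sum_support_le_card_links (e : Fin k → ZMod 2) :
    ∑ ν ∈ Finset.univ.filter (fun ν => e ν = 1), Ls ν ≤ Fintype.card (RectTorusSite Ls × Fin k) := by
  classical
  obtain ⟨m, ℓ, hm, hinj, -, -, -⟩ := exists_rectBlockPath (Ls := Ls) (Subgroup.one_mem (Subgroup.center (Multiplicative ℤ)))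
    (Finset.univ.filter fun ν => e ν = 1).toList (Finset.nodup_toList _)
  rw [Finset.sum_map_toList] at hm
  have h := Fintype.card_le_of_injective _ hinj
  rwa [Fintype.card_fin, hm] at h

/-- **`e^{−|J| n P} c₀^{N − Σ_{e_μ=1} Ls μ} λ^{Σ_{e_μ=1} Ls μ} ≤ ‖T ∘ P_e‖`** for EVERY flux `e` on every rectangular tube
(the staircase path along the support of `e`, the empty path for `e = 0`; `ρ(z) = −1`, `z` central, unitary continuous
`ρ`, `n ≠ 0`). [cite: tHooft1979Flux] [cite: MontvayMunster1994, §3.2.6] -/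
theorem rectTubeSectorNorm_ge (hρ : Continuous ρ) (hρu : ∀ g, ρ g ∈ Matrix.unitaryGroup (Fin n) ℂ) (hn : n ≠ 0)
    {z : G} (hz : z ∈ Subgroup.center G) (hρz : ρ z = -1) {lam : ℝ}
    (hM : ∀ i j, ∫ c, (Real.exp (J * (ρ c).trace.re) : ℂ) * ρ c i j ∂haarProbability G = if i = j then (lam : ℂ) else 0)
    (e : Fin k → ZMod 2) :
    Real.exp (-(|J| * (n * (Fintype.card (RectTorusSite Ls) * Fintype.card {p : Fin k × Fin k // p.1 < p.2})))) *
        ((∫ g, Real.exp (J * (ρ g).trace.re) ∂haarProbability G) ^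
            (Fintype.card (RectTorusSite Ls × Fin k) - ∑ ν ∈ Finset.univ.filter (fun ν => e ν = 1), Ls ν) *
          lam ^ (∑ ν ∈ Finset.univ.filter (fun ν => e ν = 1), Ls ν)) ≤
      rectTubeSectorNorm ρ z J Ls e := by
  classical
  obtain ⟨m, ℓ, hm, hinj, -, hWg, hWs⟩ := exists_rectBlockPath (Ls := Ls) hz
    (Finset.univ.filter fun ν => e ν = 1).toList (Finset.nodup_toList _)
  rw [Finset.sum_map_toList] at hm
  rw [← hm]
  refine rectTubeSectorNorm_ge_of_pathState ρ J hρ hρu hn hz hM ℓ hinj e (fun γ b => ?_) (fun s b => ?_)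
  · dsimp only
    rw [hWg γ b, map_mul, map_mul, Matrix.trace_mul_cycle, ← map_mul, inv_mul_cancel, map_one, one_mul]
  · have he : ∀ ν, e ν = 1 ↔ ν ∈ (Finset.univ.filter fun ν => e ν = 1).toList := fun ν => by
      rw [Finset.mem_toList, Finset.mem_filter]
      exact ⟨fun h => ⟨Finset.mem_univ ν, h⟩, fun h => h.2⟩
    rw [hWs s b, map_mul, map_list_prod_ite_center ρ hρz, re_trace_smul_one_mul,
      fluxSign_eq_list_prod e s (Finset.nodup_toList _) he]

end PathState

end Summit.Ventures.YMGap.FlowData
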